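import Mathlib
import HarnessLib

/-!
# Friedlander–Iwaniec, *The polynomial `X² + Y⁴` captures its primes*, §12: inserting the separated
# kernel `B(x,y) = ∬ h(u,t) e(ux) y^{it} du dt`, (12.13)–(12.15)

[FI, §12, p. 51 of arXiv:math/9811185 = Ann. of Math. (2) 148 (1998), 945–1040]: "we represent
`B(x, y)` as the Fourier–Mellin transform in `x` and `y` respectively, (12.13)
`f(|x|y) g(|x|) = ∬ h(u,t) e(ux) y^{it} du dt` … From these estimates it follows that the `L₁`-norm of
`h(u, t)` satisfies (12.14) `∬ |h(u,t)| du dt ≪ (log 2H)²`.  Applying (12.13) to (12.10) we infer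
that (12.15) `V_{cm}(f,g) ≪ (log 2H)² ∑_q |∑∑_{r₁s₂ ≡ r₂s₁ (mq), (r₁,r₂)=1} γ_{r₁s₁} γ̃_{r₂s₂} (q/(r₁r₂))|`
where (12.16) `γ_{rs} = r^{it} e(us/(cr)) (s/r) α_{crs}` for some real `u` and `t` (the `∼` denotes
complex conjugation except for `r^{it}` which remains unchanged)."

This file PROVES that step abstractly (`norm_sum_mul_kernel_le`): given
* a majorant `F` with Mellin representation `F(w) = ∫ M(t) w^{2πit} dt` (`w > 0`) — the tree's
  `exists_majorant_mellinKernel` (`…SmoothMajorantMellinKernel`),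
* a cutoff `g` with `g(0) = 0` and, for every `t`, a kernel `Ĝ_t ∈ L¹` with
  `g(|x|)|x|^{2πit} = ∫ Ĝ_t(u) e(ux) du` and `‖Ĝ_t‖₁ ≤ K(1+|t|)²L²` — the tree's
  `exists_cutoff_fourierKernel` (`…CutoffFourierKernel`, `L = 1 + log(b/a)`),
* finitely many `q ≥ 1`, reduced box variables `t₁, t₂ ≥ 1`, `s₁, s₂`, coefficients `β` and a
  condition `P` (FI: `mq ∣ t₁s₂ − t₂s₁`, `(t₁,t₂) = 1`),
* a bound `B` for `∑_q |∑∑_P γ_{t₁s₁}(u,t) conj(δ_{t₂s₂}(u,t)) (q/(t₁t₂))|` uniform in `(u, t)`, with the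
  twisted vectors `γ = β · t₁^{2πit} e(us₁/(ct₁))`, `δ = β · t₂^{-2πit} e(us₂/(ct₂))` (so that
  `γ δ̄ = β₁β̄₂ (t₁t₂)^{2πit} e(u(s₁/(ct₁) − s₂/(ct₂)))`, FI's `γ γ̃`),
the smoothed flipped form obeys
`|∑_q ∑∑_P β₁ β̄₂ (q/(t₁t₂)) F(|x| y/D) g(|x|)| ≤ B · K L² ∫ (1+|t|)² |M(t)| dt`,
`x = s₁/(ct₁) − s₂/(ct₂)`, `y = ct₁t₂/q` (FI's `B(x, y)` with `f(y) = F(y/D)`).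
No definitions, no named facts; the `(log 2H)²` of (12.14)–(12.15) is `L² = (1 + log H)²` here, and
the `t`-integral is finite by the rapid decay of `M`.

## References

* J. Friedlander, H. Iwaniec, *The polynomial `X² + Y⁴` captures its primes*, Ann. of Math. (2) 148
  (1998), 945–1040, §12, (12.13)–(12.16). [FriedlanderIwaniecAnnals1998]
-/

noncomputable section

open Finset Real Complex MeasureTheory
open scoped NumberTheorySymbols ComplexConjugate

namespace Literature.NumberTheory.Sieve.FriedlanderIwaniecPrimes

/-- `conj e(ab) = e(−ab)` for real `a, b`. [folklore] -/
private theorem conj_cexp_two_pi (a b : ℝ) :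
    conj (Complex.exp (2 * π * I * a * b)) = Complex.exp (-(2 * π * I * a * b)) := by
  rw [← Complex.exp_conj]
  congr 1
  simp only [map_mul, map_ofNat, Complex.conj_ofReal, Complex.conj_I]
  ring

/-- `conj e(−ab) = e(ab)` for real `a, b`. [folklore] -/
private theorem conj_cexp_neg_two_pi (a b : ℝ) :
    conj (Complex.exp (-(2 * π * I * a * b))) = Complex.exp (2 * π * I * a * b) := by
  rw [← Complex.exp_conj]
  congr 1
  simp only [map_neg, map_mul, map_ofNat, Complex.conj_ofReal, Complex.conj_I]
  ring

/-- `|e(ab)| = 1`. [folklore] -/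
private theorem norm_cexp_two_pi (a b : ℝ) : ‖Complex.exp (2 * π * I * a * b)‖ = 1 := by
  rw [Complex.norm_exp]
  simp

/-- `|e(−ab)| = 1`. [folklore] -/
private theorem norm_cexp_neg_two_pi (a b : ℝ) : ‖Complex.exp (-(2 * π * I * a * b))‖ = 1 := by
  rw [Complex.norm_exp]
  simp

/-- Iterated five-fold sums as one sum over the product. [folklore] -/
private theorem sum₅_eq_sum_product (𝒬 IT IS : Finset ℕ) (G : ℕ → ℕ → ℕ → ℕ → ℕ → ℂ) :
    ∑ q ∈ 𝒬, ∑ t₁ ∈ IT, ∑ s₁ ∈ IS, ∑ t₂ ∈ IT, ∑ s₂ ∈ IS, G q t₁ s₁ t₂ s₂ =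
      ∑ x ∈ 𝒬 ×ˢ (IT ×ˢ (IS ×ˢ (IT ×ˢ IS))), G x.1 x.2.1 x.2.2.1 x.2.2.2.1 x.2.2.2.2 := by
  rw [Finset.sum_product]
  refine sum_congr rfl fun q _ => ?_
  rw [Finset.sum_product]
  refine sum_congr rfl fun t₁ _ => ?_
  rw [Finset.sum_product]
  refine sum_congr rfl fun s₁ _ => ?_
  rw [Finset.sum_product]

/-- **(12.13)–(12.15), kernel insertion** [FI, §12]: see the module docstring.  For `c, D ≥ 1`,
`F(w) = ∫ M(t) e^{2πit log w} dt` (`w > 0`) with `M` continuous and `|t|^k M` integrable, a cutoff `g`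
with `g(0) = 0` and kernels `Ĝ_t` (`g(|x|)e^{2πit log|x|} = ∫ Ĝ_t(u)e(ux)du`,
`‖Ĝ_t‖₁ ≤ K(1+|t|)²L²`), and a bound `B` for the twisted bilinear forms uniform in `(u,t)`:
`|∑_{q} ∑∑_{P} β_{t₁s₁} β̄_{t₂s₂} (q/(t₁t₂)) F(|x|·(ct₁t₂/q)/D) g(|x|)| ≤ B · K L² ∫ (1+|t|)²|M(t)| dt`,
`x = s₁/(ct₁) − s₂/(ct₂)`. [cite: FriedlanderIwaniecAnnals1998, §12, (12.13)–(12.16)] -/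
theorem norm_sum_mul_kernel_le {c D : ℕ} (hc : 0 < c) (hD : 0 < D)
    {F : ℝ → ℝ} {M : ℝ → ℂ} (hMc : Continuous M)
    (hMi : ∀ k : ℕ, Integrable (fun t : ℝ => |t| ^ k * ‖M t‖))
    (hFM : ∀ w : ℝ, 0 < w → (F w : ℂ) = ∫ t : ℝ, M t * Complex.exp (2 * π * I * t * Real.log w))
    {g : ℝ → ℝ} (hg00 : g 0 = 0) {K L : ℝ}
    (hĜ : ∀ t : ℝ, ∃ Ĝ : ℝ → ℂ, Integrable Ĝ ∧ (∫ u, ‖Ĝ u‖) ≤ K * (1 + |t|) ^ 2 * L ^ 2 ∧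
      ∀ x : ℝ, ((g |x| : ℝ) : ℂ) * Complex.exp (2 * π * I * t * (Real.log |x| : ℝ)) =
        ∫ u, Ĝ u * Complex.exp (2 * π * I * u * x))
    (𝒬 IT IS : Finset ℕ) (h𝒬 : ∀ q ∈ 𝒬, 0 < q) (hIT : ∀ r ∈ IT, 0 < r)
    (β : ℕ → ℕ → ℂ) (P : ℕ → ℕ → ℕ → ℕ → ℕ → Prop) [∀ q t₁ s₁ t₂ s₂, Decidable (P q t₁ s₁ t₂ s₂)]
    {B : ℝ}
    (hB : ∀ u t : ℝ, ∑ q ∈ 𝒬, ‖∑ t₁ ∈ IT, ∑ s₁ ∈ IS, ∑ t₂ ∈ IT, ∑ s₂ ∈ IS,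
      (if P q t₁ s₁ t₂ s₂ then
        (β t₁ s₁ * Complex.exp (2 * π * I * t * Real.log t₁) *
            Complex.exp (2 * π * I * u * ((s₁ : ℝ) / (c * t₁) : ℝ))) *
          conj (β t₂ s₂ * Complex.exp (-(2 * π * I * t * Real.log t₂)) *
            Complex.exp (2 * π * I * u * ((s₂ : ℝ) / (c * t₂) : ℝ))) *
          (J((q : ℤ) | t₁ * t₂) : ℂ) else 0)‖ ≤ B) :
    ‖∑ q ∈ 𝒬, ∑ t₁ ∈ IT, ∑ s₁ ∈ IS, ∑ t₂ ∈ IT, ∑ s₂ ∈ IS,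
      (if P q t₁ s₁ t₂ s₂ then β t₁ s₁ * conj (β t₂ s₂) * (J((q : ℤ) | t₁ * t₂) : ℂ) *
        ((F (|(s₁ : ℝ) / (c * t₁) - (s₂ : ℝ) / (c * t₂)| * ((c : ℝ) * t₁ * t₂ / q) / D) *
          g |(s₁ : ℝ) / (c * t₁) - (s₂ : ℝ) / (c * t₂)| : ℝ) : ℂ) else 0)‖ ≤
      B * (K * L ^ 2 * ∫ t : ℝ, (1 + |t|) ^ 2 * ‖M t‖) := by
  -- shorthand for the pair data
  set Pairs := 𝒬 ×ˢ (IT ×ˢ (IS ×ˢ (IT ×ˢ IS))) with hPairs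
  -- positivity of the data on `Pairs`
  have hB0 : 0 ≤ B := (hB 0 0).trans' (sum_nonneg fun _ _ => norm_nonneg _)
  have hMint : Integrable M := by
    have h := hMi 0
    simp only [pow_zero, one_mul] at h
    exact (integrable_norm_iff hMc.aestronglyMeasurable).mp h
  have hW : Integrable (fun t : ℝ => (1 + |t|) ^ 2 * ‖M t‖) := by
    have h0 := hMi 0
    have h1 := hMi 1
    have h2 := hMi 2
    have e : (fun t : ℝ => (1 + |t|) ^ 2 * ‖M t‖) =
        fun t => |t| ^ 0 * ‖M t‖ + 2 * (|t| ^ 1 * ‖M t‖) + |t| ^ 2 * ‖M t‖ := by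
      ext t; ring
    rw [e]
    exact (h0.add (h1.const_mul 2)).add h2
  -- the function of one pair, as a function of `t`
  -- `X = s₁/(ct₁) − s₂/(ct₂)`, `y = ct₁t₂/q`
  -- Step 1: the pointwise Mellin representation of `F(|X|y/D) g(|X|)`
  have hstep1 : ∀ x ∈ Pairs,
      ((F (|(x.2.2.1 : ℝ) / (c * x.2.1) - (x.2.2.2.2 : ℝ) / (c * x.2.2.2.1)| *
          ((c : ℝ) * x.2.1 * x.2.2.2.1 / x.1) / D) *
        g |(x.2.2.1 : ℝ) / (c * x.2.1) - (x.2.2.2.2 : ℝ) / (c * x.2.2.2.1)| : ℝ) : ℂ) =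
      ∫ t : ℝ, M t * (Complex.exp (2 * π * I * t *
          Real.log (((c : ℝ) * x.2.1 * x.2.2.2.1 / x.1) / D)) *
        (((g |(x.2.2.1 : ℝ) / (c * x.2.1) - (x.2.2.2.2 : ℝ) / (c * x.2.2.2.1)| : ℝ) : ℂ) *
          Complex.exp (2 * π * I * t *
            (Real.log |(x.2.2.1 : ℝ) / (c * x.2.1) - (x.2.2.2.2 : ℝ) / (c * x.2.2.2.1)| : ℝ)))) := by
    intro x hx
    obtain ⟨q, t₁, s₁, t₂, s₂⟩ := x
    simp only [hPairs, mem_product] at hx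
    obtain ⟨hq, ht₁, _, ht₂, _⟩ := hx
    dsimp only
    set X : ℝ := (s₁ : ℝ) / (c * t₁) - (s₂ : ℝ) / (c * t₂) with hX
    set y : ℝ := (c : ℝ) * t₁ * t₂ / q with hy
    have hq0 : (0 : ℝ) < q := by exact_mod_cast h𝒬 q hq
    have hc0 : (0 : ℝ) < c := by exact_mod_cast hc
    have hD0 : (0 : ℝ) < D := by exact_mod_cast hD
    have ht₁0 : (0 : ℝ) < t₁ := by exact_mod_cast hIT t₁ ht₁
    have ht₂0 : (0 : ℝ) < t₂ := by exact_mod_cast hIT t₂ ht₂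
    have hy0 : 0 < y := by rw [hy]; positivity
    have hyD : 0 < y / D := div_pos hy0 hD0
    by_cases hX0 : X = 0
    · -- both sides vanish since `g(0) = 0`
      rw [hX0, abs_zero, hg00]
      simp
    · have hXpos : 0 < |X| := abs_pos.mpr hX0
      have hw : 0 < |X| * y / D := by positivity
      rw [Complex.ofReal_mul, hFM _ hw, ← integral_mul_const]
      refine integral_congr_ae (Filter.Eventually.of_forall fun t => ?_)
      have hlog : Real.log (|X| * y / D) = Real.log |X| + Real.log (y / D) := by
        rw [mul_div_assoc, Real.log_mul hXpos.ne' hyD.ne']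
      rw [hlog]
      push_cast
      rw [show 2 * (π : ℂ) * I * t * ((Real.log |X| : ℝ) + (Real.log (y / D) : ℝ)) =
          2 * π * I * t * (Real.log (y / D) : ℝ) + 2 * π * I * t * (Real.log |X| : ℝ) by ring,
        Complex.exp_add]
      ring
  -- Step 2: the summands as `t`-integrals, and their integrability
  -- `Tf x t = [P] A(x) · M(t) · e^{2πit log(y/D)} · g(|X|) e^{2πit log|X|}`
  set A : ℕ × ℕ × ℕ × ℕ × ℕ → ℂ := fun x =>
    β x.2.1 x.2.2.1 * conj (β x.2.2.2.1 x.2.2.2.2) * (J((x.1 : ℤ) | x.2.1 * x.2.2.2.1) : ℂ) with hA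
  set Tf : ℕ × ℕ × ℕ × ℕ × ℕ → ℝ → ℂ := fun x t =>
    if P x.1 x.2.1 x.2.2.1 x.2.2.2.1 x.2.2.2.2 then
      A x * (M t * (Complex.exp (2 * π * I * t *
          Real.log (((c : ℝ) * x.2.1 * x.2.2.2.1 / x.1) / D)) *
        (((g |(x.2.2.1 : ℝ) / (c * x.2.1) - (x.2.2.2.2 : ℝ) / (c * x.2.2.2.1)| : ℝ) : ℂ) *
          Complex.exp (2 * π * I * t *
            (Real.log |(x.2.2.1 : ℝ) / (c * x.2.1) - (x.2.2.2.2 : ℝ) / (c * x.2.2.2.1)| : ℝ)))))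
    else 0 with hTf
  have hV : (∑ q ∈ 𝒬, ∑ t₁ ∈ IT, ∑ s₁ ∈ IS, ∑ t₂ ∈ IT, ∑ s₂ ∈ IS,
      (if P q t₁ s₁ t₂ s₂ then β t₁ s₁ * conj (β t₂ s₂) * (J((q : ℤ) | t₁ * t₂) : ℂ) *
        ((F (|(s₁ : ℝ) / (c * t₁) - (s₂ : ℝ) / (c * t₂)| * ((c : ℝ) * t₁ * t₂ / q) / D) *
          g |(s₁ : ℝ) / (c * t₁) - (s₂ : ℝ) / (c * t₂)| : ℝ) : ℂ) else 0)) =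
      ∑ x ∈ Pairs, ∫ t : ℝ, Tf x t := by
    rw [sum₅_eq_sum_product]
    refine sum_congr rfl fun x hx => ?_
    by_cases hP : P x.1 x.2.1 x.2.2.1 x.2.2.2.1 x.2.2.2.2
    · simp only [hTf, if_pos hP]
      rw [hstep1 x hx, ← integral_const_mul]
    · simp only [hTf, if_neg hP, integral_zero]
  have hTint : ∀ x ∈ Pairs, Integrable (Tf x) := by
    intro x _
    by_cases hP : P x.1 x.2.1 x.2.2.1 x.2.2.2.1 x.2.2.2.2
    · simp only [hTf, if_pos hP]
      refine Integrable.const_mul (hMint.mul_bdd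
        (c := ‖(((g |(x.2.2.1 : ℝ) / (c * x.2.1) - (x.2.2.2.2 : ℝ) / (c * x.2.2.2.1)| : ℝ) : ℂ))‖) ?_ ?_) _
      · exact (by fun_prop : Continuous fun t : ℝ => Complex.exp (2 * π * I * t *
            Real.log (((c : ℝ) * x.2.1 * x.2.2.2.1 / x.1) / D)) *
          (((g |(x.2.2.1 : ℝ) / (c * x.2.1) - (x.2.2.2.2 : ℝ) / (c * x.2.2.2.1)| : ℝ) : ℂ) *
            Complex.exp (2 * π * I * t *
              (Real.log |(x.2.2.1 : ℝ) / (c * x.2.1) - (x.2.2.2.2 : ℝ) / (c * x.2.2.2.1)| : ℝ)))).aestronglyMeasurable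
      · refine Filter.Eventually.of_forall fun t => ?_
        rw [norm_mul, norm_mul, norm_cexp_two_pi, norm_cexp_two_pi, one_mul, mul_one]
    · simp only [hTf, if_neg hP]
      exact integrable_zero _ _ _
  -- Step 3: for fixed `t`, insert the Fourier kernel and bound by `B ‖M t‖ ‖Ĝ_t‖₁`
  have hpt : ∀ t : ℝ, ‖∑ x ∈ Pairs, Tf x t‖ ≤ B * (K * (1 + |t|) ^ 2 * L ^ 2) * ‖M t‖ := by
    intro t
    obtain ⟨Ĝ, hĜi, hĜ1, hĜrep⟩ := hĜ t
    -- the `u`-integrands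
    set Uf : ℕ × ℕ × ℕ × ℕ × ℕ → ℝ → ℂ := fun x u =>
      if P x.1 x.2.1 x.2.2.1 x.2.2.2.1 x.2.2.2.2 then
        (A x * M t * Complex.exp (2 * π * I * t *
            Real.log (((c : ℝ) * x.2.1 * x.2.2.2.1 / x.1) / D))) *
          (Ĝ u * Complex.exp (2 * π * I * u *
            ((x.2.2.1 : ℝ) / (c * x.2.1) - (x.2.2.2.2 : ℝ) / (c * x.2.2.2.1) : ℝ)))
      else 0 with hUf
    have hTU : ∀ x ∈ Pairs, Tf x t = ∫ u, Uf x u := by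
      intro x _
      by_cases hP : P x.1 x.2.1 x.2.2.1 x.2.2.2.1 x.2.2.2.2
      · simp only [hTf, hUf, if_pos hP]
        rw [hĜrep, ← mul_assoc, ← mul_assoc, ← integral_const_mul]
      · simp only [hTf, hUf, if_neg hP, integral_zero]
    have hUint : ∀ x ∈ Pairs, Integrable (Uf x) := by
      intro x _
      by_cases hP : P x.1 x.2.1 x.2.2.1 x.2.2.2.1 x.2.2.2.2
      · simp only [hUf, if_pos hP]
        refine Integrable.const_mul (hĜi.mul_bdd (c := 1) ?_ ?_) _
        · exact (by fun_prop : Continuous fun u : ℝ => Complex.exp (2 * π * I * u *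
            ((x.2.2.1 : ℝ) / (c * x.2.1) - (x.2.2.2.2 : ℝ) / (c * x.2.2.2.1) : ℝ))).aestronglyMeasurable
        · exact Filter.Eventually.of_forall fun u => (norm_cexp_two_pi _ _).le
      · simp only [hUf, if_neg hP]
        exact integrable_zero _ _ _
    -- pointwise in `u`: the phases recombine into the twisted vectors
    have hpu : ∀ u : ℝ, ‖∑ x ∈ Pairs, Uf x u‖ ≤ B * ‖M t‖ * ‖Ĝ u‖ := by
      intro u
      -- factor `M t Ĝ u`
      have hfac : ∑ x ∈ Pairs, Uf x u = M t * Ĝ u * ∑ x ∈ Pairs,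
          (if P x.1 x.2.1 x.2.2.1 x.2.2.2.1 x.2.2.2.2 then
            A x * Complex.exp (2 * π * I * t * Real.log (((c : ℝ) * x.2.1 * x.2.2.2.1 / x.1) / D)) *
              Complex.exp (2 * π * I * u *
                ((x.2.2.1 : ℝ) / (c * x.2.1) - (x.2.2.2.2 : ℝ) / (c * x.2.2.2.1) : ℝ)) else 0) := by
        rw [mul_sum]
        refine sum_congr rfl fun x _ => ?_
        simp only [hUf]
        split_ifs
        · ring
        · rw [mul_zero]
      -- back to iterated sums, with the phase `e^{2πit(log c − log q − log D)}` pulled out of each `q`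
      have hiter : ∑ x ∈ Pairs,
          (if P x.1 x.2.1 x.2.2.1 x.2.2.2.1 x.2.2.2.2 then
            A x * Complex.exp (2 * π * I * t * Real.log (((c : ℝ) * x.2.1 * x.2.2.2.1 / x.1) / D)) *
              Complex.exp (2 * π * I * u *
                ((x.2.2.1 : ℝ) / (c * x.2.1) - (x.2.2.2.2 : ℝ) / (c * x.2.2.2.1) : ℝ)) else 0) =
          ∑ q ∈ 𝒬, Complex.exp (2 * π * I * t * (Real.log c - Real.log q - Real.log D : ℝ)) *
            ∑ t₁ ∈ IT, ∑ s₁ ∈ IS, ∑ t₂ ∈ IT, ∑ s₂ ∈ IS,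
            (if P q t₁ s₁ t₂ s₂ then
              (β t₁ s₁ * Complex.exp (2 * π * I * t * Real.log t₁) *
                  Complex.exp (2 * π * I * u * ((s₁ : ℝ) / (c * t₁) : ℝ))) *
                conj (β t₂ s₂ * Complex.exp (-(2 * π * I * t * Real.log t₂)) *
                  Complex.exp (2 * π * I * u * ((s₂ : ℝ) / (c * t₂) : ℝ))) *
                (J((q : ℤ) | t₁ * t₂) : ℂ) else 0) := by
        simp only [hA, hPairs]
        refine Eq.trans (sum₅_eq_sum_product 𝒬 IT IS (fun q t₁ s₁ t₂ s₂ =>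
          if P q t₁ s₁ t₂ s₂ then
            β t₁ s₁ * conj (β t₂ s₂) * (J((q : ℤ) | t₁ * t₂) : ℂ) *
              Complex.exp (2 * π * I * t * Real.log (((c : ℝ) * t₁ * t₂ / q) / D)) *
              Complex.exp (2 * π * I * u * ((s₁ : ℝ) / (c * t₁) - (s₂ : ℝ) / (c * t₂) : ℝ))
          else 0)).symm ?_
        refine sum_congr rfl fun q hq => ?_
        rw [mul_sum]
        refine sum_congr rfl fun t₁ ht₁ => ?_
        rw [mul_sum]
        refine sum_congr rfl fun s₁ _ => ?_
        rw [mul_sum]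
        refine sum_congr rfl fun t₂ ht₂ => ?_
        rw [mul_sum]
        refine sum_congr rfl fun s₂ _ => ?_
        split_ifs with hP
        · have hq0 : (0 : ℝ) < q := by exact_mod_cast h𝒬 q hq
          have hc0 : (0 : ℝ) < c := by exact_mod_cast hc
          have hD0 : (0 : ℝ) < D := by exact_mod_cast hD
          have ht₁0 : (0 : ℝ) < t₁ := by exact_mod_cast hIT t₁ ht₁
          have ht₂0 : (0 : ℝ) < t₂ := by exact_mod_cast hIT t₂ ht₂
          have hlog : Real.log (((c : ℝ) * t₁ * t₂ / q) / D) =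
              Real.log c + Real.log t₁ + Real.log t₂ - Real.log q - Real.log D := by
            rw [Real.log_div (by positivity) hD0.ne', Real.log_div (by positivity) hq0.ne',
              Real.log_mul (by positivity) ht₂0.ne', Real.log_mul hc0.ne' ht₁0.ne']
          simp only [map_mul, conj_cexp_neg_two_pi, conj_cexp_two_pi]
          rw [hlog]
          -- collect the exponentials
          have hE : Complex.exp (2 * π * I * t *
                ((Real.log c + Real.log t₁ + Real.log t₂ - Real.log q - Real.log D : ℝ) : ℂ)) *
              Complex.exp (2 * π * I * u * (((s₁ : ℝ) / (c * t₁) - (s₂ : ℝ) / (c * t₂) : ℝ) : ℂ)) =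
              Complex.exp (2 * π * I * t * ((Real.log c - Real.log q - Real.log D : ℝ) : ℂ)) *
                (Complex.exp (2 * π * I * t * (Real.log t₁ : ℂ)) *
                  Complex.exp (2 * π * I * u * (((s₁ : ℝ) / (c * t₁) : ℝ) : ℂ))) *
                (Complex.exp (2 * π * I * t * (Real.log t₂ : ℂ)) *
                  Complex.exp (-(2 * π * I * u * (((s₂ : ℝ) / (c * t₂) : ℝ) : ℂ)))) := by
            simp only [← Complex.exp_add]
            congr 1
            push_cast
            ring
          calc β t₁ s₁ * conj (β t₂ s₂) * (J((q : ℤ) | t₁ * t₂) : ℂ) *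
                Complex.exp (2 * π * I * t *
                  ((Real.log c + Real.log t₁ + Real.log t₂ - Real.log q - Real.log D : ℝ) : ℂ)) *
                Complex.exp (2 * π * I * u * (((s₁ : ℝ) / (c * t₁) - (s₂ : ℝ) / (c * t₂) : ℝ) : ℂ))
              = β t₁ s₁ * conj (β t₂ s₂) * (J((q : ℤ) | t₁ * t₂) : ℂ) *
                (Complex.exp (2 * π * I * t *
                  ((Real.log c + Real.log t₁ + Real.log t₂ - Real.log q - Real.log D : ℝ) : ℂ)) *
                Complex.exp (2 * π * I * u * (((s₁ : ℝ) / (c * t₁) - (s₂ : ℝ) / (c * t₂) : ℝ) : ℂ))) := by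
                ring
            _ = _ := by rw [hE]; ring
        · rw [mul_zero]
      rw [hfac, hiter, norm_mul, norm_mul]
      have hph : ∀ q : ℕ, ‖Complex.exp (2 * π * I * t * (Real.log c - Real.log q - Real.log D : ℝ))‖ = 1 :=
        fun q => norm_cexp_two_pi _ _
      have hin : ‖∑ q ∈ 𝒬, Complex.exp (2 * π * I * t * (Real.log c - Real.log q - Real.log D : ℝ)) *
            ∑ t₁ ∈ IT, ∑ s₁ ∈ IS, ∑ t₂ ∈ IT, ∑ s₂ ∈ IS,
            (if P q t₁ s₁ t₂ s₂ then
              (β t₁ s₁ * Complex.exp (2 * π * I * t * Real.log t₁) *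
                  Complex.exp (2 * π * I * u * ((s₁ : ℝ) / (c * t₁) : ℝ))) *
                conj (β t₂ s₂ * Complex.exp (-(2 * π * I * t * Real.log t₂)) *
                  Complex.exp (2 * π * I * u * ((s₂ : ℝ) / (c * t₂) : ℝ))) *
                (J((q : ℤ) | t₁ * t₂) : ℂ) else 0)‖ ≤ B := by
        refine (norm_sum_le _ _).trans ?_
        refine le_trans (sum_le_sum fun q _ => ?_) (hB u t)
        rw [norm_mul, hph q, one_mul]
      calc ‖M t‖ * ‖Ĝ u‖ * _ ≤ ‖M t‖ * ‖Ĝ u‖ * B := by gcongr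
        _ = B * ‖M t‖ * ‖Ĝ u‖ := by ring
    -- integrate in `u`
    have hsumU : ∑ x ∈ Pairs, Tf x t = ∫ u, ∑ x ∈ Pairs, Uf x u := by
      rw [integral_finsetSum Pairs hUint]
      exact sum_congr rfl hTU
    have hMK : 0 ≤ B * ‖M t‖ := mul_nonneg hB0 (norm_nonneg _)
    calc ‖∑ x ∈ Pairs, Tf x t‖ = ‖∫ u, ∑ x ∈ Pairs, Uf x u‖ := by rw [hsumU]
      _ ≤ ∫ u, ‖∑ x ∈ Pairs, Uf x u‖ := norm_integral_le_integral_norm _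
      _ ≤ ∫ u, B * ‖M t‖ * ‖Ĝ u‖ :=
          integral_mono_of_nonneg (Filter.Eventually.of_forall fun u => norm_nonneg _)
            (hĜi.norm.const_mul _) (Filter.Eventually.of_forall hpu)
      _ = B * ‖M t‖ * ∫ u, ‖Ĝ u‖ := integral_const_mul _ _
      _ ≤ B * ‖M t‖ * (K * (1 + |t|) ^ 2 * L ^ 2) := by gcongr
      _ = B * (K * (1 + |t|) ^ 2 * L ^ 2) * ‖M t‖ := by ring
  -- Step 4: integrate in `t`
  rw [hV, ← integral_finsetSum Pairs hTint]
  calc ‖∫ t, ∑ x ∈ Pairs, Tf x t‖ ≤ ∫ t, ‖∑ x ∈ Pairs, Tf x t‖ := norm_integral_le_integral_norm _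
    _ ≤ ∫ t, B * (K * (1 + |t|) ^ 2 * L ^ 2) * ‖M t‖ := by
        refine integral_mono_of_nonneg (Filter.Eventually.of_forall fun t => norm_nonneg _) ?_
          (Filter.Eventually.of_forall hpt)
        have e : (fun t : ℝ => B * (K * (1 + |t|) ^ 2 * L ^ 2) * ‖M t‖) =
            fun t => (B * (K * L ^ 2)) * ((1 + |t|) ^ 2 * ‖M t‖) := by
          ext t; ring
        rw [e]
        exact hW.const_mul _
    _ = B * (K * L ^ 2 * ∫ t : ℝ, (1 + |t|) ^ 2 * ‖M t‖) := by
        rw [← integral_const_mul, ← integral_const_mul]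
        refine integral_congr_ae (Filter.Eventually.of_forall fun t => ?_)
        ring

end Literature.NumberTheory.Sieve.FriedlanderIwaniecPrimes
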